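import Mathlib
import Summits.ValiantsHypothesis.ValiantsHypothesis.Theses.ElementaryWordLength
import Literature.Computability.AlgebraicComplexity.CircuitDepthProofs
import Literature.Computability.AlgebraicComplexity.QuasiPolynomialFormulasProofs

/-!
# Route ElementaryWordLength — `WordToFormula` (stmt-ValiantsHypothesis-6630)

The converse row of the Ben-Or–Cleve dictionary between affine elementary words in `E₃(ℂ[x̄])` and
arithmetic formulas: if the transvection `E₁₃(f) = 1 + f·e₁₃` is a product of at most `L` letters
`E_ij(λ)`, `E_ij(λ·x_k)`, then `f` has a fan-in-two formula of size `≤ 20 (L+1)³`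
(Ben-Or–Cleve 1992, §3, the "only if" direction of Thm 1; BCS 1997, Ex. 21.9 / Rem. (21.34)).

## Proof (divide and conquer on the matrix product)

* Every entry of a letter matrix `1 + single i j (C λ * v)` (`v = 1` or `v = X k`) is
  `(0 | 1) + (C λ * v | 0)`, an expression of size `≤ 2` (`hasFormula_letter_apply`).
* An entry of a product `A * B` of `3 × 3` matrices is `Σ_c A_ac B_cb`: three products and two sums,
  so entries with formulas of size `≤ m` give entries with formulas of size `≤ 6m + 5`
  (`hasFormula_mul_apply`).
* Hence, splitting a list of `≤ 2^m` matrices into two halves of `≤ 2^(m-1)` (`List.take/drop`),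
  every entry of the product has a formula of size `≤ 3·6^m − 1` (`hasFormula_prod_apply`;
  `6(3·6^m − 1) + 5 = 3·6^(m+1) − 1`).
* With `m = Nat.log 2 L + 1` (`L < 2^m`, `2^(m-1) ≤ L + 1`): `3·6^m − 1 = 18·6^(log₂ L) − 1 ≤
  18·8^(log₂ L) ≤ 18 (L+1)³ ≤ 20 (L+1)³`, and `f` is the `(0,2)` entry of the product.

Formulas are handled only through the witness predicate
`∃ P, P.WellFormed ∧ P.IsFormula ∧ P.IsFanInTwo ∧ P.eval = g ∧ P.size ≤ m` and its closure lemmas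
`exists_formula_C / _X / _add / _mul / _mono` of `QuasiPolynomialFormulasProofs.lean`, and
`formulaComplexity_le_size` (`CircuitDepthProofs.lean`). No new definitions.
-/

-- `Summit.<Summit>.<Problem>` repeats `ValiantsHypothesis` by the tree's layout convention (D-0017).
set_option linter.dupNamespace false

namespace Summit.ValiantsHypothesis.ValiantsHypothesis.Theorems.ElementaryWordLength

open MvPolynomial Literature.Computability.AlgebraicComplexity
open Literature.Computability.AlgebraicComplexity.ArithCircuit

variable {σ : Type}

/-- Entries of the identity matrix (`0` or `1`) are expressions of size `0`
(BCS 1997, §21.1, p. 549: constants are expressions of size `0`). [folklore] -/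
theorem hasFormula_one_apply (a b : Fin 3) :
    ∃ P : ArithCircuit ℂ σ, P.WellFormed ∧ P.IsFormula ∧ P.IsFanInTwo ∧
      P.eval = (1 : Matrix (Fin 3) (Fin 3) (MvPolynomial σ ℂ)) a b ∧ P.size ≤ 0 := by
  rw [Matrix.one_apply]
  split_ifs
  · simpa using exists_formula_C (σ := σ) (1 : ℂ)
  · simpa using exists_formula_C (σ := σ) (0 : ℂ)

/-- The leaf of a letter, `1` (no variable) or `X k`, is an expression of size `0`. [folklore] -/
theorem hasFormula_leaf (v : Option σ) :
    ∃ P : ArithCircuit ℂ σ, P.WellFormed ∧ P.IsFormula ∧ P.IsFanInTwo ∧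
      P.eval = (v.elim 1 MvPolynomial.X : MvPolynomial σ ℂ) ∧ P.size ≤ 0 := by
  cases v with
  | none => simpa using exists_formula_C (σ := σ) (1 : ℂ)
  | some x => simpa using exists_formula_X (k := ℂ) x

/-- Every entry of a letter matrix `E_ij(λ·v) = 1 + single i j (C λ * v)` (`v = 1` or `X k`) is an
expression of size `≤ 2`: `(0 | 1) + (C λ * v | 0)` (Ben-Or–Cleve 1992, §3). [folklore] -/
theorem hasFormula_letter_apply (l : Fin 3 × Fin 3 × ℂ × Option σ) (a b : Fin 3) :
    ∃ P : ArithCircuit ℂ σ, P.WellFormed ∧ P.IsFormula ∧ P.IsFanInTwo ∧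
      P.eval = (Matrix.transvection l.1 l.2.1
        (MvPolynomial.C l.2.2.1 * l.2.2.2.elim 1 MvPolynomial.X)) a b ∧ P.size ≤ 2 := by
  have hc := exists_formula_mul (exists_formula_C (σ := σ) l.2.2.1) (hasFormula_leaf l.2.2.2)
  have hone := hasFormula_one_apply (σ := σ) a b
  rw [Matrix.transvection, Matrix.add_apply, Matrix.single_apply]
  split_ifs
  · exact exists_formula_mono (exists_formula_add hone hc) (by norm_num)
  · have h0 := exists_formula_C (σ := σ) (0 : ℂ)
    rw [MvPolynomial.C_0] at h0
    exact exists_formula_mono (exists_formula_add hone h0) (by norm_num)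

/-- Entries of a product of two `3 × 3` matrices: `(A B)_ab = Σ_c A_ac B_cb` is three products and
two sums, so entrywise expressions of size `≤ m` give entrywise expressions of size `≤ 6m + 5`
(Ben-Or–Cleve 1992, §3; BCS 1997, §21.1). [folklore] -/
theorem hasFormula_mul_apply {A B : Matrix (Fin 3) (Fin 3) (MvPolynomial σ ℂ)} {m : ℕ}
    (hA : ∀ a b : Fin 3, ∃ P : ArithCircuit ℂ σ, P.WellFormed ∧ P.IsFormula ∧ P.IsFanInTwo ∧
      P.eval = A a b ∧ P.size ≤ m)
    (hB : ∀ a b : Fin 3, ∃ P : ArithCircuit ℂ σ, P.WellFormed ∧ P.IsFormula ∧ P.IsFanInTwo ∧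
      P.eval = B a b ∧ P.size ≤ m)
    (a b : Fin 3) :
    ∃ P : ArithCircuit ℂ σ, P.WellFormed ∧ P.IsFormula ∧ P.IsFanInTwo ∧
      P.eval = (A * B) a b ∧ P.size ≤ 6 * m + 5 := by
  rw [Matrix.mul_apply, Fin.sum_univ_three]
  have h0 := exists_formula_mul (hA a 0) (hB 0 b)
  have h1 := exists_formula_mul (hA a 1) (hB 1 b)
  have h2 := exists_formula_mul (hA a 2) (hB 2 b)
  exact exists_formula_mono (exists_formula_add (exists_formula_add h0 h1) h2) (by omega)

/-- Divide and conquer (Ben-Or–Cleve 1992, §3, converse of Thm 1): if every entry of every matrix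
of a list of at most `2^m` matrices is an expression of size `≤ 2`, then every entry of the product
is an expression of size `≤ 3·6^m − 1` — split the list into two halves of length `≤ 2^(m-1)` and
use `hasFormula_mul_apply` (`6(3·6^m − 1) + 5 = 3·6^(m+1) − 1`). [folklore] -/
theorem hasFormula_prod_apply (m : ℕ) :
    ∀ Ms : List (Matrix (Fin 3) (Fin 3) (MvPolynomial σ ℂ)),
      (∀ M ∈ Ms, ∀ a b : Fin 3, ∃ P : ArithCircuit ℂ σ, P.WellFormed ∧ P.IsFormula ∧
        P.IsFanInTwo ∧ P.eval = M a b ∧ P.size ≤ 2) →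
      Ms.length ≤ 2 ^ m →
      ∀ a b : Fin 3, ∃ P : ArithCircuit ℂ σ, P.WellFormed ∧ P.IsFormula ∧ P.IsFanInTwo ∧
        P.eval = Ms.prod a b ∧ P.size ≤ 3 * 6 ^ m - 1 := by
  induction m with
  | zero =>
    intro Ms hMs hlen a b
    rcases Ms with _ | ⟨M, _ | ⟨M', Ms'⟩⟩
    · rw [List.prod_nil]
      exact exists_formula_mono (hasFormula_one_apply a b) (by norm_num)
    · rw [List.prod_cons, List.prod_nil, mul_one]
      exact exists_formula_mono (hMs M (by simp) a b) (by norm_num)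
    · exfalso
      simp only [List.length_cons, pow_zero] at hlen
      omega
  | succ m ih =>
    intro Ms hMs hlen a b
    have hA := ih (Ms.take (2 ^ m)) (fun M hM => hMs M (List.mem_of_mem_take hM))
      (by rw [List.length_take]; exact Nat.min_le_left _ _)
    have hB := ih (Ms.drop (2 ^ m)) (fun M hM => hMs M (List.mem_of_mem_drop hM))
      (by rw [List.length_drop, pow_succ] at *; omega)
    rw [← List.take_append_drop (2 ^ m) Ms, List.prod_append]
    refine exists_formula_mono (hasFormula_mul_apply hA hB a b) ?_
    have h6 : 1 ≤ 6 ^ m := Nat.one_le_pow _ _ (by norm_num)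
    rw [pow_succ]
    omega

/-- The arithmetic of the final bound: `3·6^(log₂ L + 1) − 1 ≤ 20 (L+1)³`, via
`6^(log₂ L) ≤ 8^(log₂ L) = (2^(log₂ L))³ ≤ (L+1)³`. [folklore] -/
theorem three_mul_six_pow_log_succ_le (L : ℕ) :
    3 * 6 ^ (Nat.log 2 L + 1) - 1 ≤ 20 * (L + 1) ^ 3 := by
  have h1 : 2 ^ Nat.log 2 L ≤ L + 1 := by
    rcases Nat.eq_zero_or_pos L with rfl | hL
    · simp
    · exact (Nat.pow_log_le_self 2 hL.ne').trans (Nat.le_succ L)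
  have h2 : 6 ^ Nat.log 2 L ≤ (L + 1) ^ 3 :=
    calc 6 ^ Nat.log 2 L ≤ 8 ^ Nat.log 2 L := Nat.pow_le_pow_left (by norm_num) _
      _ = (2 ^ Nat.log 2 L) ^ 3 := by
          rw [← pow_mul, mul_comm, pow_mul]; norm_num
      _ ≤ (L + 1) ^ 3 := Nat.pow_le_pow_left h1 3
  rw [pow_succ]
  generalize 6 ^ Nat.log 2 L = t at h2 ⊢
  generalize (L + 1) ^ 3 = s at h2 ⊢
  omega

/-- **`WordToFormula` (stmt-ValiantsHypothesis-6630), the converse dictionary row.**  If the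
transvection `E₁₃(f) = transvection 0 2 f ∈ SL₃(ℂ[x̄])` is the product of a word of at most `L`
elementary letters `E_ij(λ)`, `E_ij(λ·x_k)` (`i ≠ j`, `λ ∈ ℂ`), then `f` has a fan-in-two arithmetic
formula of size at most `20 (L+1)³`: `f` is the `(0,2)` entry of the product, and the entries of a
product of `≤ 2^m` letter matrices are expressions of size `≤ 3·6^m − 1` by divide and conquer
(`hasFormula_prod_apply` with `m = log₂ L + 1`; exponent `log₂ 6 < 3`). The letter condition
`i ≠ j` is not needed for this direction. (Ben-Or–Cleve 1992, §3, converse half of Thm 1;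
BCS 1997, Rem. (21.34).) [folklore] -/
theorem wordToFormula_proof :
    Summit.ValiantsHypothesis.ValiantsHypothesis.Theses.ElementaryWordLength.WordToFormula := by
  intro σ f L hw
  obtain ⟨w, hwL, -, hprod⟩ := hw
  have hMs : ∀ M ∈ w.map (fun l => Matrix.transvection l.1 l.2.1
      (MvPolynomial.C l.2.2.1 * l.2.2.2.elim 1 MvPolynomial.X)), ∀ a b : Fin 3,
      ∃ P : ArithCircuit ℂ σ, P.WellFormed ∧ P.IsFormula ∧ P.IsFanInTwo ∧
        P.eval = M a b ∧ P.size ≤ 2 := by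
    intro M hM a b
    obtain ⟨l, -, rfl⟩ := List.mem_map.1 hM
    exact hasFormula_letter_apply l a b
  have hlen : (w.map (fun l => Matrix.transvection l.1 l.2.1
      (MvPolynomial.C l.2.2.1 * l.2.2.2.elim 1 MvPolynomial.X))).length ≤
      2 ^ (Nat.log 2 L + 1) := by
    rw [List.length_map]
    exact hwL.trans (Nat.lt_pow_succ_log_self one_lt_two L).le
  obtain ⟨P, -, hPf, hP2, hPe, hPs⟩ := hasFormula_prod_apply (Nat.log 2 L + 1) _ hMs hlen 0 2
  rw [hprod, Matrix.transvection, Matrix.add_apply, Matrix.single_apply_same,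
    Matrix.one_apply_ne (by decide), zero_add] at hPe
  calc formulaComplexity f ≤ P.size := formulaComplexity_le_size hPf hP2 hPe
    _ ≤ 3 * 6 ^ (Nat.log 2 L + 1) - 1 := hPs
    _ ≤ 20 * (L + 1) ^ 3 := three_mul_six_pow_log_succ_le L

end Summit.ValiantsHypothesis.ValiantsHypothesis.Theorems.ElementaryWordLength
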